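import Summits.BirchSwinnertonDyer.Rank1Residual.X5.KummerRelaxedStrictCount
import Summits.BirchSwinnertonDyer.Rank1Residual.X5.TransverseSelfDual
import HarnessLib
/-!
# The relaxed/strict count at the SOLITAIRE LEVELS: transverse at a finite set `T` of Kolyvagin
# primes, Kummer elsewhere — `[H¹_{𝓚(T)^{v₀}} : H¹_{𝓚(T)_{v₀}}] = #E(K_{v₀})[p] · #(𝓞_{v₀}/p)`
# (cell `b2b-bsdres`; O1 PROVER ORDER v2.8 item (ii) G3-T4, follow-up (ii-b) "the transverse local
# conditions at solitaire level `n > 1`: `a(n) − b(n) = 1 + e`" (cells/o1/PLAN.md C134 R-G18.6;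
# REFUTER-O1 §19 D5); assembly of `X5/SelfDualRelaxedStrictCount.lean` §4,
# `X5/KummerRelaxedStrictCount.lean` §5 and `X5/TransverseSelfDual.lean` §M; file 1 of 2 (file 2:
# `X5/TransverseRelaxedStrictCountLevels.lean` — Rubin / Kolyvagin-datum spellings and `K = ℚ`, `p = 2`);
# seat x11b3-p9 GEN 3, cross-cell pool work)

HONEST FRAMING (cell `b2b-bsdres`, run/shared/lean/b2b/bsd-rank1-residual/, verbatim in every file): the
goal of the cell is to DELETE the COMBINATION-SHAPED residual classes of the Birch–Swinnerton-Dyer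
formula for ALL analytic-rank `≤ 1` elliptic curves over `ℚ` — "full BSD formula for every rank `≤ 1`
curve in class `C`" assembled STRICTLY from published theorems — so that the rank-`≤ 1` remainder
becomes exactly the CONSTRUCTION-SHAPED classes, which are TYPED (missing-input `Prop`s), NOT
attempted. This is not "finishing BSD". Team O1 (X5 at `p = 2`): research routes; O1 OPEN; nothing
booked; no mark / label / count moved. THEOREMS ONLY: no definition, no named fact is minted, no
`sorry`. CONDITIONAL (hypotheses, exactly as the parent files): a family `inv` of local invariant maps
with the properties of the tree's named fact `poitouTate_selmerStructure_duality` (Howard 2004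
Thm. 2.1.11, Milne ADT I Cor. 2.3 / Thm. 4.10: `IsPerfect`, `SumLocalTermEqZero`, `SelmerComplement`),
Tate's local Euler–Poincaré characteristic at the finite places (named fact
`localEulerPoincareCharacteristic`, Milne ADT I Thm. 2.8), the injectivity of `inv_w` at the REAL
places (`hreal`; `Br(ℝ) = ½ℤ/ℤ`, NOT in the tree's fact), and at each prime `𝔮 ∈ T` the Kolyvagin-prime
hypotheses BY NAME (`p ∉ 𝔮`, `E[p]` unramified at `𝔮`, `N𝔮 = ℓ` prime, `(ℓ − 1)·E[p] = 0`, the mod-`ℓ` cyclotomic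
character onto on the inertia group of `K_𝔮`, and the `Γ_{K_𝔮}`-fixed `p`-torsion cyclic).

## What this file proves

* §N1 `dualTransported_eq_self_of_eq_kummer_off`, **`relIndex_update_bot_update_top_eq_of_eq_kummer_off`**
  — ASSEMBLY: a Selmer structure `𝓛` on `E[n]` (`n` a prime power) which IS the Kummer condition off a
  finite set `T` of primes and is residually self-dual (`w⁻¹(𝓛_𝔮^*) = 𝓛_𝔮`) at the primes of `T` is
  residually self-dual EVERYWHERE (`X5/KummerRelaxedStrictCount` §5), hence
  `[H¹_{𝓛^{v₀}} : H¹_{𝓛_{v₀}}] = #E(K_{v₀})[n] · #(𝓞_{v₀}/n)` at every finite `v₀`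
  (`X5/SelfDualRelaxedStrictCount` §4 on an exceptional set `S ⊇ T ∪ {v₀} ∪ ∞ ∪ {v ∣ p} ∪ {bad}`);
* §N2 `exists_forall_eq_nsmul_of_natCard_le` — a `p`-torsion subgroup of order `≤ p` is cyclic
  (the "cyclicity flag" form of §M's generator hypothesis);
* §N3 **`relIndex_transverseAt_update_bot_update_top_eq`** — THE LEVEL COUNT: for a prime `p` and a
  finite set `T` of Kolyvagin primes of `(E, p)`, the structure
  `𝓚(T) = 𝓚.transverseAt (cyclotomicTransverse E[p]) T` ("transverse `H¹_tr(K_𝔮, E[p])` at `𝔮 ∈ T`,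
  Kummer elsewhere": Sakamoto Def. 3.3 `𝓕(c)`, Rubin PCMI Def. 2.1.1, Mazur–Rubin Def. 2.1.1/§4.3 —
  the vertices of the Selmer sheaf / of lens-2's solitaire cube) satisfies
  `[H¹_{𝓚(T)^{v₀}} : H¹_{𝓚(T)_{v₀}}] = #E(K_{v₀})[p] · #(𝓞_{v₀}/p)`, the transverse conditions being
  Lagrangian (`X5/TransverseSelfDual` §M); `relIndex_transverseAt_update_bot_update_top_eq_of_natCard_le`
  is the same with the cyclicity flag `#E[p]^{Γ_{K_𝔮}} ≤ p` in place of the generator hypothesis.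

References: [MazurRubin2004] Def. 1.1.6, Prop. 1.3.2, Def. 2.1.1, §4.3; [Rubin2011] Def. 1.9.4,
Prop. 1.9.5, Def. 2.1.1; [Sakamoto2024] §3.1.2, Def. 3.3, Def. 3.9; [Howard2004HeegnerKolyvagin]
Thm. 2.1.11; [MilneADT2006] I Cor. 2.3, Thm. 2.8, Thm. 2.13, Thm. 4.10, Lemma 6.15; [DDT] Thm. 2.19;
[SilvermanAEC2009] III.8.1, VII.4.1.
-/

noncomputable section

open scoped Classical

open CategoryTheory Field Function NumberField IsDedekindDomain WeierstrassCurve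
open Literature.NumberTheory.EllipticCurves
open Literature.NumberTheory.GaloisRepresentations
open Literature.NumberTheory.GaloisRepresentations.DiscreteGaloisModule (mu MuCarrier SelmerStructure
  localTatePairingZMod tateDual localMap transverseSubgroup)
open Literature.NumberTheory.GaloisCohomology
open Summit.BirchSwinnertonDyer.Rank1Residual.X11b.LocBridge
open Summit.BirchSwinnertonDyer.Rank1Residual.X11b.Levels
open scoped ContRepresentation

namespace Summit.BirchSwinnertonDyer.Rank1Residual.X5.TransverseCount

-- No local-instance attribute in this file: the finiteness of `E[n]` needed to STATE the
-- transported dual `w⁻¹(𝓛_v^*)` (§N1) is the explicit instance binder `[Finite (geomTorsion W n)]`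
-- (discharged by `finite_geomTorsion_of_neZero` in §N3, where `n = p` is a prime).

/-! ## §N1. ASSEMBLY: Kummer off `T`, residually self-dual on `T` ⟹ the relaxed/strict count -/

section Assembly

variable {K : Type} [Field K] [NumberField K] (W : WeierstrassCurve K) (n : ℕ) [NeZero n]
  [W.IsElliptic] [Finite (geomTorsion W n)]
variable (e : geomTorsion W n → geomTorsion W n → AlgebraicClosure K)
  (hμ : ∀ S T, e S T ^ n = 1)
  (hadd₁ : ∀ S₁ S₂ T, e (S₁ + S₂) T = e S₁ T * e S₂ T)
  (hadd₂ : ∀ S T₁ T₂, e S (T₁ + T₂) = e S T₁ * e S T₂)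
  (hgal : ∀ (σ : absoluteGaloisGroup K) (S T : geomTorsion W n), σ • e S T = e (σ • S) (σ • T))
  (halt : ∀ T, e T T = 1) (hnondeg : ∀ T, (∀ S, e S T = 1) → T = 0)
  (inv : LocalInvariants K n)

omit [Finite (geomTorsion W n)] in
/-- The transported dual condition `w⁻¹(𝓛_v^*)` depends only on the local condition `𝓛_v`
(Sakamoto §3.1.2: it is defined place by place). [cite: Sakamoto2024, §3.1.2 (p. 924)] -/
theorem dualTransported_congr {𝓛 𝓛' : SelmerStructure (W.torsionGaloisModule n)} {v : Place K}
    (h : 𝓛 v = 𝓛' v) :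
    inv.dualTransported 𝓛 (weilDualIntertwining W n e hμ hadd₁ hadd₂ hgal) v =
      inv.dualTransported 𝓛' (weilDualIntertwining W n e hμ hadd₁ hadd₂ hgal) v := by
  ext y
  simp only [LocalInvariants.mem_dualTransported_iff, LocalInvariants.dualSelmerStructure_apply, h]

include halt hnondeg in
/-- **A structure which is Kummer off `T` and residually self-dual on `T` is residually self-dual
at EVERY place** (`n` a prime power): at the infinite places and at the primes `𝔮 ∉ T` it is the
Kummer condition, self-dual by `X5/KummerRelaxedStrictCount` §5
(`SelfDualCount.dualTransported_kummerSelmerStructure_eq`: n1011-p18 at the finite places, archimedean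
Tate duality at the real places under `hreal`, nothing at the complex places); at `𝔮 ∈ T` by the
hypothesis `hon`.  Sakamoto Def. 3.9: NO place is exceptional for `𝓛`.
[cite: Sakamoto2024, §3.1.2 and Def. 3.9 (p. 924)] [cite: MilneADT2006, Ch. I, Cor. 3.4 and Thm. 2.13] -/
theorem dualTransported_eq_self_of_eq_kummer_off (hn : IsPrimePow n) (hperf : inv.IsPerfect)
    (hEP : ∀ v : HeightOneSpectrum (𝓞 K), localEulerPoincareCharacteristic (v.adicCompletion K))
    (hreal : ∀ w : InfinitePlace K, w.IsReal → Injective (inv (Sum.inl w)))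
    (T : Finset (HeightOneSpectrum (𝓞 K))) {𝓛 : SelmerStructure (W.torsionGaloisModule n)}
    (hinl : ∀ w : InfinitePlace K, 𝓛 (Sum.inl w) = W.kummerSelmerStructure n (Sum.inl w))
    (hinr : ∀ q : HeightOneSpectrum (𝓞 K), q ∉ T → 𝓛 (Sum.inr q) = W.kummerSelmerStructure n (Sum.inr q))
    (hon : ∀ q ∈ T, inv.dualTransported 𝓛 (weilDualIntertwining W n e hμ hadd₁ hadd₂ hgal) (Sum.inr q) =
      𝓛 (Sum.inr q))
    (v : Place K) :
    inv.dualTransported 𝓛 (weilDualIntertwining W n e hμ hadd₁ hadd₂ hgal) v = 𝓛 v := by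
  rcases v with w | q
  · rw [dualTransported_congr W n e hμ hadd₁ hadd₂ hgal inv (hinl w), hinl w]
    exact SelfDualCount.dualTransported_kummerSelmerStructure_eq W n e hμ hadd₁ hadd₂ hgal halt hnondeg
      inv hn hperf hEP hreal (Sum.inl w)
  · by_cases hq : q ∈ T
    · exact hon q hq
    · rw [dualTransported_congr W n e hμ hadd₁ hadd₂ hgal inv (hinr q hq), hinr q hq]
      exact SelfDualCount.dualTransported_kummerSelmerStructure_eq W n e hμ hadd₁ hadd₂ hgal halt hnondeg
        inv hn hperf hEP hreal (Sum.inr q)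

include halt hnondeg in
/-- **ASSEMBLY — the relaxed/strict count for a structure that is Kummer off a finite set of primes
`T` and residually self-dual on `T`.**  For a prime power `n`, an elliptic curve `E` over a number
field `K` (`K : Type`), Weil pairing data `e` on `E[n]`, a family `inv` of local invariant maps with
the three Poitou–Tate properties of the tree's named fact `poitouTate_selmerStructure_duality K` and
injective at the real places (`hreal`, a HYPOTHESIS), Tate's local Euler characteristic at the finite
places (`hEP`, a HYPOTHESIS), and a Selmer structure `𝓛` on `E[n]` with `𝓛_v = 𝓚_v` (Kummer) at every
place not in `T` (`hinl`, `hinr`) and `w⁻¹(𝓛_𝔮^*) = 𝓛_𝔮` at `𝔮 ∈ T` (`hon`; supplied at Kolyvagin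
primes by `X5/TransverseSelfDual` §M), at every finite place `v₀`:

  `[H¹_{𝓛^{v₀}}(K, E[n]) : H¹_{𝓛_{v₀}}(K, E[n])] = #E(K_{v₀})[n] · #(𝓞_{v₀}/n)`.

Proof: `X5/SelfDualRelaxedStrictCount` §4 (`relIndex_update_bot_update_top_eq_of_localEuler`, Howard
Thm. 2.1.11 at one place) on a finite exceptional set `S ⊇ T ∪ {v₀} ∪ ∞ ∪ {v ∣ p} ∪ {bad}`
(`X11b.KummerPT.exists_exceptional_finset`), `𝓛` being unramified outside `S` because `𝓚` is
(`X11b.KummerDuality.kummerSelmerStructure_isUnramifiedOutside`) and residually self-dual away from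
`v₀` by `dualTransported_eq_self_of_eq_kummer_off`.  CONDITIONAL on the stated hypotheses; nothing
booked; O1 OPEN. [cite: Howard2004HeegnerKolyvagin, Thm. 2.1.11 (arXiv:1202.6340 p. 6)]
[cite: MilneADT2006, Ch. I, Thm. 2.8, Cor. 3.4, Thm. 4.10 and Lemma 6.15]
[cite: Sakamoto2024, §3.1.2, Def. 3.3 and Def. 3.9 (pp. 922–924)] -/
theorem relIndex_update_bot_update_top_eq_of_eq_kummer_off (hn : IsPrimePow n)
    (hperf : inv.IsPerfect) (hvan : inv.SumLocalTermEqZero) (hcomp : inv.SelmerComplement)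
    (hEP : ∀ v : HeightOneSpectrum (𝓞 K), localEulerPoincareCharacteristic (v.adicCompletion K))
    (hreal : ∀ w : InfinitePlace K, w.IsReal → Injective (inv (Sum.inl w)))
    (T : Finset (HeightOneSpectrum (𝓞 K))) {𝓛 : SelmerStructure (W.torsionGaloisModule n)}
    (hinl : ∀ w : InfinitePlace K, 𝓛 (Sum.inl w) = W.kummerSelmerStructure n (Sum.inl w))
    (hinr : ∀ q : HeightOneSpectrum (𝓞 K), q ∉ T → 𝓛 (Sum.inr q) = W.kummerSelmerStructure n (Sum.inr q))
    (hon : ∀ q ∈ T, inv.dualTransported 𝓛 (weilDualIntertwining W n e hμ hadd₁ hadd₂ hgal) (Sum.inr q) =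
      𝓛 (Sum.inr q))
    (w₀ : HeightOneSpectrum (𝓞 K)) :
    (SelmerStructure.selmerGroup
          (Function.update 𝓛 (Sum.inr w₀) ⊥ : SelmerStructure (W.torsionGaloisModule n))).relIndex
        (SelmerStructure.selmerGroup
          (Function.update 𝓛 (Sum.inr w₀) ⊤ : SelmerStructure (W.torsionGaloisModule n))) =
      Nat.card (nsmulAddMonoidHom n : (W.baseChange (w₀.adicCompletion K)).toAffine.Point →+ _).ker *
        Nat.card (w₀.adicCompletionIntegers K ⧸ Ideal.span {(n : w₀.adicCompletionIntegers K)}) := by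
  -- `n = p^k`, `p` prime, `k ≥ 1`
  obtain ⟨p, k, hp, hk, rfl⟩ := (isPrimePow_nat_iff n).mp hn
  haveI : Fact p.Prime := ⟨hp⟩
  -- a finite exceptional set `S ⊇ T ∪ {v₀} ∪ ∞ ∪ {v ∣ p} ∪ {bad}`
  obtain ⟨S, hS'S, hinf, hpS, hbad⟩ := X11b.KummerPT.exists_exceptional_finset W p
    (insert (Sum.inr w₀ : Place K) (T.image (fun q : HeightOneSpectrum (𝓞 K) => (Sum.inr q : Place K))))
  have hw₀ : (Sum.inr w₀ : Place K) ∈ S := hS'S (Finset.mem_insert_self _ _)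
  have hTS : ∀ q ∈ T, (Sum.inr q : Place K) ∈ S := fun q hq =>
    hS'S (Finset.mem_insert_of_mem (Finset.mem_image_of_mem _ hq))
  have hS : ∀ v : HeightOneSpectrum (𝓞 K), (Sum.inr v : Place K) ∉ S →
      (((p ^ k : ℕ) : ℕ) : 𝓞 K) ∉ v.asIdeal ∧
        GaloisRep.IsUnramifiedAt v (W.torsionGaloisModule ((p ^ k : ℕ) : ℤ)) := fun v hv => by
    have hpv : ((p : ℕ) : 𝓞 K) ∉ v.asIdeal := fun h => hv (hpS v h)
    have hgood : W.HasGoodReductionAt v := by_contra fun h => hv (hbad v h)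
    have hpkv : ((p ^ k : ℕ) : 𝓞 K) ∉ v.asIdeal := by
      rw [Nat.cast_pow]
      exact fun h => hpv (v.isPrime.mem_of_pow_mem k h)
    exact ⟨hpkv, X11b.AcSelmer.isUnramifiedAt_torsionGaloisModule W hgood
      (by rw [Int.cast_natCast]; exact hpkv)⟩
  have h𝓚 : SelmerStructure.IsUnramifiedOutside (W.kummerSelmerStructure ((p ^ k : ℕ) : ℤ)) S :=
    X11b.KummerDuality.kummerSelmerStructure_isUnramifiedOutside W p k S hinf hpS hbad
  -- `𝓛` is unramified outside `S` (it is the Kummer condition off `T ⊆ S`)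
  have h𝓛 : SelmerStructure.IsUnramifiedOutside 𝓛 S := by
    refine ⟨hinf, fun v hv => ?_⟩
    have hvT : v ∉ T := fun h => hv (hTS v h)
    rw [hinr v hvT]
    exact h𝓚.2 v hv
  exact SelfDualCount.relIndex_update_bot_update_top_eq_of_localEuler W (p ^ k) e hμ hadd₁ hadd₂ hgal
    hnondeg inv hperf hvan hcomp hS h𝓛 hw₀
    (fun v _ => dualTransported_eq_self_of_eq_kummer_off W (p ^ k) e hμ hadd₁ hadd₂ hgal halt hnondeg inv
      hn hperf hEP hreal T hinl hinr hon v) hn (hEP w₀)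

end Assembly

/-! ## §N2. A `p`-torsion subgroup of order `≤ p` is cyclic (the "cyclicity flag" form of §M's
generator hypothesis) -/

section Cyclic

/-- **A `p`-torsion subgroup of order at most `p` is generated by one element** (`p` prime): either
it is `0`, or any non-zero element has order `p` and its multiples exhaust it.  Used to turn the
cyclicity flag `#E[p]^{Γ_{K_𝔮}} ≤ p` at a Kolyvagin prime into §M's generator hypothesis. [folklore] -/
theorem exists_forall_eq_nsmul_of_natCard_le {A : Type*} [AddCommGroup A] [Finite A] {p : ℕ}
    (hp : p.Prime) (H : AddSubgroup A) (hH : ∀ x ∈ H, p • x = 0) (hcard : Nat.card H ≤ p) :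
    ∃ R : A, ∀ S ∈ H, ∃ a : ℕ, S = a • R := by
  by_cases h0 : ∀ S ∈ H, S = 0
  · exact ⟨0, fun S hS => ⟨0, by rw [h0 S hS, zero_nsmul]⟩⟩
  · push Not at h0
    obtain ⟨R, hR, hR0⟩ := h0
    refine ⟨R, fun S hS => ?_⟩
    have hord : addOrderOf R = p := by
      rcases (Nat.dvd_prime hp).mp (addOrderOf_dvd_of_nsmul_eq_zero (hH R hR)) with h1 | h1
      · exact absurd (AddMonoid.addOrderOf_eq_one_iff.mp h1) hR0
      · exact h1
    have hle : AddSubgroup.zmultiples R ≤ H := (AddSubgroup.zmultiples_le).mpr hR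
    have heq : AddSubgroup.zmultiples R = H :=
      AddSubgroup.eq_of_le_of_card_ge hle (by rw [Nat.card_zmultiples, hord]; exact hcard)
    have hS' : S ∈ AddSubgroup.zmultiples R := heq ▸ hS
    rw [← mem_multiples_iff_mem_zmultiples] at hS'
    obtain ⟨a, ha⟩ := (AddSubmonoid.mem_multiples_iff _ _).mp hS'
    exact ⟨a, ha.symm⟩

end Cyclic

/-! ## §N3. THE LEVEL COUNT: transverse at the Kolyvagin primes of `T`, Kummer elsewhere -/

section Level

variable {K : Type} [Field K] [NumberField K] (W : WeierstrassCurve K) [W.IsElliptic]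

omit [W.IsElliptic] in
/-- `𝓕(c)` (transverse at `c`) is `𝓕` at the infinite places. [cite: Sakamoto2024, Def. 3.3 (p. 922)] -/
theorem transverseAt_inl {n : ℤ} (𝓕 𝒯 : SelmerStructure (W.torsionGaloisModule n))
    (c : Finset (HeightOneSpectrum (𝓞 K))) (w : InfinitePlace K) :
    𝓕.transverseAt 𝒯 c (Sum.inl w) = 𝓕 (Sum.inl w) := rfl

omit [W.IsElliptic] in
/-- `𝓕(c)_𝔮 = 𝓕_𝔮` at a prime `𝔮 ∉ c`. [cite: Sakamoto2024, Def. 3.3 (p. 922)] -/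
theorem transverseAt_inr_of_not_mem {n : ℤ} (𝓕 𝒯 : SelmerStructure (W.torsionGaloisModule n))
    {c : Finset (HeightOneSpectrum (𝓞 K))} {q : HeightOneSpectrum (𝓞 K)} (hq : q ∉ c) :
    𝓕.transverseAt 𝒯 c (Sum.inr q) = 𝓕 (Sum.inr q) :=
  SelmerStructure.modify_inr_of_not_mem 𝓕 𝒯 (Finset.notMem_empty q) (Finset.notMem_empty q) hq

omit [W.IsElliptic] in
/-- `𝓕(c)_𝔮 = 𝒯_𝔮` at a prime `𝔮 ∈ c`. [cite: Sakamoto2024, Def. 3.3 (p. 922)] -/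
theorem transverseAt_inr_of_mem {n : ℤ} (𝓕 𝒯 : SelmerStructure (W.torsionGaloisModule n))
    {c : Finset (HeightOneSpectrum (𝓞 K))} {q : HeightOneSpectrum (𝓞 K)} (hq : q ∈ c) :
    𝓕.transverseAt 𝒯 c (Sum.inr q) = 𝒯 (Sum.inr q) :=
  SelmerStructure.modify_inr_of_mem_transverse 𝓕 𝒯 (Finset.notMem_empty q) (Finset.notMem_empty q) hq


variable (p : ℕ) [hp : Fact p.Prime]

/-- **THE LEVEL COUNT — `[H¹_{𝓚(T)^{v₀}}(K, E[p]) : H¹_{𝓚(T)_{v₀}}(K, E[p])] = #E(K_{v₀})[p] · #(𝓞_{v₀}/p)`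
at every finite set `T` of Kolyvagin primes.**  Here `p` is a prime, `E/K` an elliptic curve over a
number field (`K : Type`), `𝓚 = kummerSelmerStructure p` the Kummer structure on `E[p]` (Selmer group
`Sel^{(p)}(E/K)`), and `𝓚(T) = 𝓚.transverseAt (cyclotomicTransverse E[p]) T` the structure with the
transverse condition `H¹_tr(K_𝔮, E[p]) = ker(H¹(K_𝔮, E[p]) → H¹(K_𝔮(μ_{N𝔮}), E[p]))` at the primes
`𝔮 ∈ T` and the Kummer condition at every other place (Sakamoto Def. 3.3 `𝓕(c)`; Rubin PCMI
Def. 2.1.1; the vertices `H¹_{𝓕(n)}` of Mazur–Rubin's Selmer sheaf, §4.3) — relaxed (`⊤`) resp. strict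
(`⊥`) at the finite place `v₀`.  HYPOTHESES: `inv` with `IsPerfect`, `SumLocalTermEqZero`,
`SelmerComplement` (the content of `poitouTate_selmerStructure_duality K`) and injective at the real
places (`hreal`); Tate's local Euler characteristic at the finite places (`hEP`); and at each `𝔮 ∈ T`
the Kolyvagin-prime hypotheses — `p ∉ 𝔮` (`hpT`), `E[p]` unramified at `𝔮` (`hur`; e.g. `E` good at
`𝔮 ∤ p`, `X11b.AcSelmer.isUnramifiedAt_torsionGaloisModule`), `N𝔮` prime (`hprime`), `(N𝔮 − 1)·E[p] = 0`
(`hM`; Rubin Def. 2.1.3 "`N𝔮 ≡ 1 mod p`"), the mod-`N𝔮` cyclotomic character onto `(ℤ/N𝔮)ˣ` on the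
inertia group of `K_𝔮` (`hχI`; Serre LF IV §4 Prop. 17 — proved over `ℚ` in the tree), and the
`Γ_{K_𝔮}`-fixed `p`-torsion cyclic (`hcyc`; Frobenius with a one-dimensional fixed space on `E[p]`).
Proof: §N1 with `hon` = §M (`TransverseSelfDual.annRight_invWeilPairing_transverse_eq`, read through
`SelfDualCount.dualTransported_weilDual_eq_annRight`) for the Weil pairing of the tree's PROVED
`exists_weilPairing_holds`.  At `K = ℚ`, `p = 2`: `a(T) − b(T) = 1 + e` (§N4).  CONDITIONAL on the
stated hypotheses; nothing booked; O1 OPEN. [cite: MazurRubin2004, Def. 2.1.1 and §4.3]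
[cite: Rubin2011, Def. 1.9.4, Prop. 1.9.5 and Def. 2.1.1 (pp. 14–17)]
[cite: Sakamoto2024, Def. 3.3 and Def. 3.9 (pp. 922–924)]
[cite: Howard2004HeegnerKolyvagin, Thm. 2.1.11 (arXiv:1202.6340 p. 6)]
[cite: MilneADT2006, Ch. I, Cor. 2.3, Thm. 2.8, Thm. 4.10 and Lemma 6.15] -/
theorem relIndex_transverseAt_update_bot_update_top_eq (inv : LocalInvariants K p)
    (hperf : inv.IsPerfect) (hvan : inv.SumLocalTermEqZero) (hcomp : inv.SelmerComplement)
    (hEP : ∀ v : HeightOneSpectrum (𝓞 K), localEulerPoincareCharacteristic (v.adicCompletion K))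
    (hreal : ∀ w : InfinitePlace K, w.IsReal → Injective (inv (Sum.inl w)))
    (T : Finset (HeightOneSpectrum (𝓞 K)))
    (hpT : ∀ q ∈ T, ((p : ℕ) : 𝓞 K) ∉ q.asIdeal)
    (hur : ∀ q ∈ T, GaloisRep.IsUnramifiedAt q (W.torsionGaloisModule (p : ℤ)))
    (hprime : ∀ q ∈ T, (Ideal.absNorm q.asIdeal).Prime)
    (hM : ∀ q ∈ T, ∀ m : geomTorsion W p, (Ideal.absNorm q.asIdeal - 1) • m = 0)
    (hχI : ∀ q ∈ T, ∀ [Fact (Ideal.absNorm q.asIdeal).Prime]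
      [NeZero ((Ideal.absNorm q.asIdeal : ℕ) : q.adicCompletion K)],
      ∀ u : (ZMod (Ideal.absNorm q.asIdeal))ˣ, ∃ t ∈ absInertia (q.adicCompletion K),
        modPCyclotomicCharacterZMod (q.adicCompletion K) (Ideal.absNorm q.asIdeal) t = u)
    (hcyc : ∀ q ∈ T, ∃ R : geomTorsion W p, ∀ S : geomTorsion W p,
      (∀ g : absoluteGaloisGroup (q.adicCompletion K), GaloisRep.toLocal q (W.torsionGaloisModule p) g S = S) →
        ∃ a : ℕ, S = a • R)
    (w₀ : HeightOneSpectrum (𝓞 K)) :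
    (SelmerStructure.selmerGroup (Function.update
          ((W.kummerSelmerStructure (p : ℤ)).transverseAt
            (cyclotomicTransverse (W.torsionGaloisModule (p : ℤ))) T) (Sum.inr w₀) ⊥ :
          SelmerStructure (W.torsionGaloisModule (p : ℤ)))).relIndex
        (SelmerStructure.selmerGroup (Function.update
          ((W.kummerSelmerStructure (p : ℤ)).transverseAt
            (cyclotomicTransverse (W.torsionGaloisModule (p : ℤ))) T) (Sum.inr w₀) ⊤ :
          SelmerStructure (W.torsionGaloisModule (p : ℤ)))) =
      Nat.card (nsmulAddMonoidHom p : (W.baseChange (w₀.adicCompletion K)).toAffine.Point →+ _).ker *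
        Nat.card (w₀.adicCompletionIntegers K ⧸ Ideal.span {(p : w₀.adicCompletionIntegers K)}) := by
  haveI := finite_geomTorsion_of_neZero W p
  -- a Weil pairing on `E[p]` (PROVED in the tree: `exists_weilPairing_holds`, Silverman III.8.1)
  obtain ⟨e, hμ, hadd₁, hadd₂, halt, hnondeg, hgal⟩ := exists_weilPairing_holds W p hp.out.two_le
    (Nat.cast_ne_zero.mpr hp.out.ne_zero)
  refine relIndex_update_bot_update_top_eq_of_eq_kummer_off W p e hμ hadd₁ hadd₂ hgal halt hnondeg inv
    hp.out.isPrimePow hperf hvan hcomp hEP hreal T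
    (𝓛 := (W.kummerSelmerStructure (p : ℤ)).transverseAt (cyclotomicTransverse (W.torsionGaloisModule (p : ℤ))) T)
    (fun w => transverseAt_inl W _ _ T w) (fun q hq => transverseAt_inr_of_not_mem W _ _ hq) (fun q hq => ?_) w₀
  -- at `𝔮 ∈ T`: the transverse condition is Lagrangian (§M)
  haveI : Fact (Ideal.absNorm q.asIdeal).Prime := ⟨hprime q hq⟩
  haveI : CharZero (q.adicCompletion K) :=
    charZero_of_injective_algebraMap (algebraMap K (q.adicCompletion K)).injective
  haveI : NeZero ((Ideal.absNorm q.asIdeal : ℕ) : q.adicCompletion K) :=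
    ⟨Nat.cast_ne_zero.2 (hprime q hq).ne_zero⟩
  have hI : ∀ t ∈ absInertia (q.adicCompletion K), ∀ m : geomTorsion W p,
      GaloisRep.toLocal q (W.torsionGaloisModule p) t m = m := by
    intro t ht m
    have h := (GaloisRep.isUnramifiedAt_iff_toLocal_holds q (W.torsionGaloisModule (p : ℤ))).1 (hur q hq) t ht
    rw [h]
    rfl
  obtain ⟨R, hR⟩ := hcyc q hq
  rw [transverseAt_inr_of_mem W _ _ hq, SelfDualCount.dualTransported_weilDual_eq_annRight,
    transverseAt_inr_of_mem W _ _ hq, cyclotomicTransverse_inr]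
  exact TransverseSelfDual.annRight_invWeilPairing_transverse_eq W p e hμ hadd₁ hadd₂ hgal halt hnondeg
    inv q (Ideal.absNorm q.asIdeal) (hpT q hq) rfl hI (hM q hq) (hχI q hq) (hperf q).1.injective (hEP q)
    R hR

/-- **The level count with the CYCLICITY FLAG** `#E[p]^{Γ_{K_𝔮}} ≤ p` at each `𝔮 ∈ T` in place of
§M's generator hypothesis (§N2): same conclusion
`[H¹_{𝓚(T)^{v₀}} : H¹_{𝓚(T)_{v₀}}] = #E(K_{v₀})[p] · #(𝓞_{v₀}/p)`.
[cite: MazurRubin2004, Def. 2.1.1 and §4.3] [cite: Rubin2011, Prop. 1.9.5 and Def. 2.1.1 (pp. 14–17)] -/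
theorem relIndex_transverseAt_update_bot_update_top_eq_of_natCard_le (inv : LocalInvariants K p)
    (hperf : inv.IsPerfect) (hvan : inv.SumLocalTermEqZero) (hcomp : inv.SelmerComplement)
    (hEP : ∀ v : HeightOneSpectrum (𝓞 K), localEulerPoincareCharacteristic (v.adicCompletion K))
    (hreal : ∀ w : InfinitePlace K, w.IsReal → Injective (inv (Sum.inl w)))
    (T : Finset (HeightOneSpectrum (𝓞 K)))
    (hpT : ∀ q ∈ T, ((p : ℕ) : 𝓞 K) ∉ q.asIdeal)
    (hur : ∀ q ∈ T, GaloisRep.IsUnramifiedAt q (W.torsionGaloisModule (p : ℤ)))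
    (hprime : ∀ q ∈ T, (Ideal.absNorm q.asIdeal).Prime)
    (hM : ∀ q ∈ T, ∀ m : geomTorsion W p, (Ideal.absNorm q.asIdeal - 1) • m = 0)
    (hχI : ∀ q ∈ T, ∀ [Fact (Ideal.absNorm q.asIdeal).Prime]
      [NeZero ((Ideal.absNorm q.asIdeal : ℕ) : q.adicCompletion K)],
      ∀ u : (ZMod (Ideal.absNorm q.asIdeal))ˣ, ∃ t ∈ absInertia (q.adicCompletion K),
        modPCyclotomicCharacterZMod (q.adicCompletion K) (Ideal.absNorm q.asIdeal) t = u)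
    (hflag : ∀ q ∈ T, Nat.card {S : geomTorsion W p //
      ∀ g : absoluteGaloisGroup (q.adicCompletion K), GaloisRep.toLocal q (W.torsionGaloisModule p) g S = S} ≤ p)
    (w₀ : HeightOneSpectrum (𝓞 K)) :
    (SelmerStructure.selmerGroup (Function.update
          ((W.kummerSelmerStructure (p : ℤ)).transverseAt
            (cyclotomicTransverse (W.torsionGaloisModule (p : ℤ))) T) (Sum.inr w₀) ⊥ :
          SelmerStructure (W.torsionGaloisModule (p : ℤ)))).relIndex
        (SelmerStructure.selmerGroup (Function.update
          ((W.kummerSelmerStructure (p : ℤ)).transverseAt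
            (cyclotomicTransverse (W.torsionGaloisModule (p : ℤ))) T) (Sum.inr w₀) ⊤ :
          SelmerStructure (W.torsionGaloisModule (p : ℤ)))) =
      Nat.card (nsmulAddMonoidHom p : (W.baseChange (w₀.adicCompletion K)).toAffine.Point →+ _).ker *
        Nat.card (w₀.adicCompletionIntegers K ⧸ Ideal.span {(p : w₀.adicCompletionIntegers K)}) := by
  refine relIndex_transverseAt_update_bot_update_top_eq W p inv hperf hvan hcomp hEP hreal T hpT hur
    hprime hM hχI (fun q hq => ?_) w₀
  -- the fixed `p`-torsion as a subgroup of `E[p]` (finite, Silverman III.6.4), of order `≤ p`, hence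
  -- cyclic (§N2)
  haveI := finite_geomTorsion_of_neZero W p
  let H : AddSubgroup (geomTorsion W p) :=
    { carrier := {S | ∀ g : absoluteGaloisGroup (q.adicCompletion K),
        GaloisRep.toLocal q (W.torsionGaloisModule p) g S = S}
      zero_mem' := fun g => map_zero _
      add_mem' := fun {S S'} hS hS' g => by rw [map_add, hS g, hS' g]
      neg_mem' := fun {S} hS g => by rw [map_neg, hS g] }
  have hH : ∀ x ∈ H, p • x = 0 := fun x _ => AddSubgroup.torsionBy.nsmul x
  have hcard : Nat.card H ≤ p := by
    have h : Nat.card H = Nat.card {S : geomTorsion W p //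
        ∀ g : absoluteGaloisGroup (q.adicCompletion K),
          GaloisRep.toLocal q (W.torsionGaloisModule p) g S = S} :=
      Nat.card_congr (Equiv.subtypeEquivRight fun _ => Iff.rfl)
    rw [h]
    exact hflag q hq
  obtain ⟨R, hR⟩ := exists_forall_eq_nsmul_of_natCard_le hp.out H hH hcard
  exact ⟨R, fun S hS => hR S hS⟩

end Level

end Summit.BirchSwinnertonDyer.Rank1Residual.X5.TransverseCount

end
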